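import Summits.KontsevichZagierPeriods.KontsevichZagierPeriods.Theorems.TerasomaMultiplicationBetaCancellationStubPiMulFibred

/-!
# `BetaCancellation` (stmt-KontsevichZagierPeriods-13633), line `dirichlet-companion-to-pi` — stub `stub_piMulRegion`

**Disc multiples of relations are region-respecting relations, for EVERY region `T` of the two
disc coordinates.** Let `P n r : IntegralRep (n + 2)` be the pinned disc family of item 0540
(domain `{z | z₀² + z₁² ≤ 1 ∧ (z₂, …, z_{n+1}) ∈ r.domain}`, integrand `z ↦ r.integrand (z₂, …)`)
and `L := FreeAbelianGroup.lift (of ∘ P)` (left multiplication by `[π]` in this typing). For a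
region `T ⊆ ℝ²` of the two disc coordinates, the *region-respecting generators* are: all instances
of domain additivity and of integrand additivity, the changes of variables `Φ` between
representations of dimension `n + 2` which preserve membership of `(z 0, z 1)` in `T`
(`(Φ x 0, Φ x 1) ∈ T ↔ (x 0, x 1) ∈ T` on the domain), and the Newton–Leibniz moves
`of r − of r'` with `r : IntegralRep (n + 3)` over a base `r' : IntegralRep (n + 2)` of dimension
`≥ 2`. Then `L` maps `KZ.relations` into the closure of the region-respecting generators: by
`AddSubgroup.closure_le` it suffices to treat one generator of each of the four kinds
[Kontsevich–Zagier 2001, §1.2, rules (1)–(3)]: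

* domain additivity ↦ domain additivity in dimension `k + 2` (`piMulFib_domainAdd`);
* integrand additivity ↦ integrand additivity (`piMulFib_integrandAdd`);
* a change of variables `Φ` on `r.domain ⊆ ℝᵏ` ↦ the change of variables
  `Ψ z = (z₀, z₁, Φ (z₂, …))` between representations of dimension `k + 2`, block derivative
  `id × Φ'` (conjugated by `ℝ² × ℝᵏ ≃ ℝ^{k+2}`), `|det Ψ'| = |det Φ'|`, and `Ψ z 0 = z 0`,
  `Ψ z 1 = z 1` — so `Ψ` fixes BOTH disc coordinates and a fortiori preserves membership of
  `(z 0, z 1)` in any `T` (`piMulRegion_changeOfVariables`, the proof of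
  `piMulFib_changeOfVariables` with the sharper bookkeeping);
* Newton–Leibniz (band `r : IntegralRep (k + 1)` over `r' : IntegralRep k`, last coordinate) ↦
  Newton–Leibniz along the last coordinate of `P (k+1) r : IntegralRep (k + 3)` over the base
  `P k r' : IntegralRep (k + 2)` (`piMulFib_newtonLeibniz` and
  `KZ.fibredNewtonLeibnizRel_subset_newtonLeibnizRel`; the base has dimension `k + 2 ≥ 2`).

No definitions; sorry-free; axioms ⊆ {propext, Classical.choice, Quot.sound}.

References: M. Kontsevich, D. Zagier, *Periods* (2001), §1.2 rules (1)–(3), §4.1; J. Ayoub, *Une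
version relative de la conjecture des périodes de Kontsevich–Zagier*, Ann. of Math. 181 (2015), §1.
-/

noncomputable section

-- `Summit.KontsevichZagierPeriods.KontsevichZagierPeriods.…` is the tree's mandated layout (single-conjunct summit).
set_option linter.dupNamespace false

namespace Summit.KontsevichZagierPeriods.KontsevichZagierPeriods.BetaCancellationLine

open Set
open Literature.NumberTheory.Transcendental
open Literature.NumberTheory.Transcendental.KZ
open Literature.ModelTheory.ExponentialFields (IsSemialgebraic)
open MvPolynomial (X)

variable {k : ℕ}

/-! ### The change of variables under the pinned disc family fixes both disc coordinates -/

section Generators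

variable {P : ∀ n : ℕ, IntegralRep n → IntegralRep (n + 2)}
  (hP : ∀ (n : ℕ) (r : IntegralRep n),
    (P n r).domain = {z : Fin (n + 2) → ℝ | z 0 ^ 2 + z 1 ^ 2 ≤ 1 ∧ (fun i : Fin n => z i.succ.succ) ∈ r.domain} ∧
    (P n r).integrand = fun z => r.integrand (fun i : Fin n => z i.succ.succ))
include hP

/-- **Disc × (change of variables) is a REGION-RESPECTING change of variables, for every region `T`
of the two disc coordinates.** For `Φ` on `σ = r.domain ⊆ ℝᵏ` as in rule (2), the map
`Ψ z = (z₀, z₁, Φ (z₂, …))` on `D × σ ⊆ ℝ^{k+2}` is `ℚ`-semialgebraic, injective, has derivative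
`id × Φ'` within `D × σ` (chain rule through `ℝ² × ℝᵏ ≃ ℝ^{k+2}`), image `D × Φ '' σ`,
`|det (id × Φ')| = |det Φ'|` (`LinearMap.det_conj`, `LinearMap.det_prodMap`), so
`f ∘ pr = ((f' ∘ pr) ∘ Ψ) · |det Ψ'|`; and `Ψ z 0 = z 0`, `Ψ z 1 = z 1`, whence
`(Ψ z 0, Ψ z 1) ∈ T ↔ (z 0, z 1) ∈ T` for every `T ⊆ ℝ²` (proof of `piMulFib_changeOfVariables`
with both disc coordinates recorded). [folklore] -/
theorem piMulRegion_changeOfVariables (T : Set (ℝ × ℝ)) {r r' : IntegralRep k}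
    {Φ : (Fin k → ℝ) → (Fin k → ℝ)} {Φ' : (Fin k → ℝ) → (Fin k → ℝ) →L[ℝ] (Fin k → ℝ)}
    (hΦ : IsSemialgebraicMapOn ℚ r.domain Φ)
    (hΦ' : ∀ x ∈ r.domain, HasFDerivWithinAt Φ (Φ' x) r.domain x) (hinj : InjOn Φ r.domain)
    (hdom : r'.domain = Φ '' r.domain)
    (hf : ∀ x ∈ r.domain, r.integrand x = r'.integrand (Φ x) * |(Φ' x).det|) :
    of (P k r) - of (P k r') ∈
      {x : FormalRep | ∃ (n : ℕ) (s s' : IntegralRep (n + 2)) (Ψ : (Fin (n + 2) → ℝ) → (Fin (n + 2) → ℝ))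
          (Ψ' : (Fin (n + 2) → ℝ) → (Fin (n + 2) → ℝ) →L[ℝ] (Fin (n + 2) → ℝ)),
        IsSemialgebraicMapOn ℚ s.domain Ψ ∧ (∀ x ∈ s.domain, HasFDerivWithinAt Ψ (Ψ' x) s.domain x) ∧
        Set.InjOn Ψ s.domain ∧ s'.domain = Ψ '' s.domain ∧
        (∀ x ∈ s.domain, s.integrand x = s'.integrand (Ψ x) * |(Ψ' x).det|) ∧
        (∀ x ∈ s.domain, (Ψ x 0, Ψ x 1) ∈ T ↔ (x 0, x 1) ∈ T) ∧ x = of s - of s'} := by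
  obtain ⟨hD, hI⟩ := hP k r
  obtain ⟨hD', hI'⟩ := hP k r'
  -- the linear identification `ℝ² × ℝᵏ ≃ ℝ^{k+2}` (disc coordinates first)
  let e : ((Fin 2 → ℝ) × (Fin k → ℝ)) ≃ₗ[ℝ] (Fin (k + 2) → ℝ) :=
    { toFun := fun p => Fin.cons (p.1 0) (Fin.cons (p.1 1) p.2)
      invFun := fun z => (![z 0, z 1], fun i => z i.succ.succ)
      map_add' := fun p q => by
        ext j; refine Fin.cases ?_ (fun j => Fin.cases ?_ (fun i => ?_) j) j <;> simp
      map_smul' := fun c p => by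
        ext j; refine Fin.cases ?_ (fun j => Fin.cases ?_ (fun i => ?_) j) j <;> simp
      left_inv := fun p => by
        ext j
        · fin_cases j <;> simp
        · simp
      right_inv := fun z => by
        ext j; refine Fin.cases ?_ (fun j => Fin.cases ?_ (fun i => ?_) j) j <;> simp }
  let eL : ((Fin 2 → ℝ) × (Fin k → ℝ)) ≃L[ℝ] (Fin (k + 2) → ℝ) := e.toContinuousLinearEquiv
  have heL_symm : ∀ z, eL.symm z = (![z 0, z 1], fun i => z i.succ.succ) := fun z => rfl
  -- the block map and its derivative
  let Ψ : (Fin (k + 2) → ℝ) → (Fin (k + 2) → ℝ) := eL ∘ Prod.map id Φ ∘ eL.symm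
  let Ψ' : (Fin (k + 2) → ℝ) → (Fin (k + 2) → ℝ) →L[ℝ] (Fin (k + 2) → ℝ) := fun z =>
    (eL : _ →L[ℝ] _).comp ((((ContinuousLinearMap.id ℝ (Fin 2 → ℝ)).prodMap
      (Φ' (fun i => z i.succ.succ))).comp (eL.symm : _ →L[ℝ] _)))
  have hΨ : ∀ z, Ψ z = Fin.cons (z 0) (Fin.cons (z 1) (Φ fun i => z i.succ.succ)) := fun z => rfl
  have hΨ0 : ∀ z, Ψ z 0 = z 0 := fun z => by rw [hΨ, Fin.cons_zero]
  have hΨ1 : ∀ z, Ψ z 1 = z 1 := fun z => by rw [hΨ, Fin.cons_one, Fin.cons_zero]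
  have hΨ2 : ∀ z (i : Fin k), Ψ z i.succ.succ = Φ (fun i => z i.succ.succ) i := fun z i => by
    rw [hΨ, Fin.cons_succ, Fin.cons_succ]
  have hdet : ∀ z, (Ψ' z).det = (Φ' (fun i => z i.succ.succ)).det := by
    intro z
    have hcoe : ((Ψ' z : (Fin (k + 2) → ℝ) →L[ℝ] (Fin (k + 2) → ℝ)) :
        (Fin (k + 2) → ℝ) →ₗ[ℝ] (Fin (k + 2) → ℝ)) =
      (e : ((Fin 2 → ℝ) × (Fin k → ℝ)) →ₗ[ℝ] (Fin (k + 2) → ℝ)) ∘ₗ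
        (((LinearMap.id : (Fin 2 → ℝ) →ₗ[ℝ] (Fin 2 → ℝ)).prodMap
          ((Φ' (fun i => z i.succ.succ) : (Fin k → ℝ) →L[ℝ] (Fin k → ℝ)) :
            (Fin k → ℝ) →ₗ[ℝ] (Fin k → ℝ))) ∘ₗ
        (e.symm : (Fin (k + 2) → ℝ) →ₗ[ℝ] ((Fin 2 → ℝ) × (Fin k → ℝ)))) :=
      LinearMap.ext fun v => rfl
    change LinearMap.det _ = LinearMap.det _
    rw [hcoe, LinearMap.det_conj, LinearMap.det_prodMap, LinearMap.det_id, one_mul]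
  have hS : (P k r).domain = eL.symm ⁻¹' (piDisc ×ˢ r.domain) := by
    ext z
    rw [hD, mem_preimage, heL_symm, mem_prod, mem_setOf_eq, mem_piDisc]
    simp
  have hDs : IsSemialgebraic ℚ (P k r).domain := (P k r).isSemialgebraic_domain
  have hmaps : ∀ z ∈ (P k r).domain, (fun i : Fin k => z i.succ.succ) ∈ r.domain := by
    intro z hz
    rw [hD] at hz
    exact hz.2
  refine ⟨k, P k r, P k r', Ψ, Ψ', ?_, ?_, ?_, ?_, ?_, ?_, rfl⟩
  · -- semialgebraic, coordinatewise
    refine IsSemialgebraicMapOn.of_forall hDs fun j => ?_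
    refine Fin.cases ?_ (fun j => Fin.cases ?_ (fun i => ?_) j) j
    · simp only [hΨ0]
      convert isSemialgebraicFunOn_aeval hDs (X 0 : MvPolynomial (Fin (k + 2)) ℚ) using 2 with z
      simp
    · simp only [Fin.succ_zero_eq_one, hΨ1]
      convert isSemialgebraicFunOn_aeval hDs (X 1 : MvPolynomial (Fin (k + 2)) ℚ) using 2 with z
      simp
    · simp only [hΨ2]
      exact piMulFib_isSemialgebraicFunOn_comp_tail hDs
        ((isSemialgebraicMapOn_iff_forall_holds r.isSemialgebraic_domain).mp hΦ i) hmaps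
  · -- derivative within the cylinder
    intro z hz
    have hx : (fun i => z i.succ.succ) ∈ r.domain := hmaps z hz
    have hg : HasFDerivWithinAt (Prod.map id Φ)
        ((ContinuousLinearMap.id ℝ (Fin 2 → ℝ)).prodMap (Φ' (fun i => z i.succ.succ)))
        (piDisc ×ˢ r.domain) (eL.symm z) := by
      refine HasFDerivWithinAt.prodMap (eL.symm z) (hasFDerivWithinAt_id _ _) ((hΦ' _ hx).mono ?_)
      rintro _ ⟨q, hq, rfl⟩
      exact hq.2
    have h2 := (eL.comp_hasFDerivWithinAt_iff).mpr hg
    have h3 := (eL.symm.comp_right_hasFDerivWithinAt_iff (f := eL ∘ Prod.map id Φ)).mpr h2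
    rw [hS]
    exact h3
  · -- injective
    intro z₁ hz₁ z₂ hz₂ h
    have h0 : z₁ 0 = z₂ 0 := by rw [← hΨ0 z₁, ← hΨ0 z₂, h]
    have h1 : z₁ 1 = z₂ 1 := by rw [← hΨ1 z₁, ← hΨ1 z₂, h]
    have h2 : Φ (fun i => z₁ i.succ.succ) = Φ (fun i => z₂ i.succ.succ) := by
      funext i
      rw [← hΨ2 z₁, ← hΨ2 z₂, h]
    have htl := hinj (hmaps z₁ hz₁) (hmaps z₂ hz₂) h2
    funext j
    refine Fin.cases ?_ (fun j => Fin.cases ?_ (fun i => ?_) j) j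
    · exact h0
    · simpa using h1
    · exact congrFun htl i
  · -- image
    ext w
    rw [hD', hD, mem_setOf_eq, mem_image]
    constructor
    · rintro ⟨hw, hw'⟩
      rw [hdom] at hw'
      obtain ⟨x, hx, hwx⟩ := hw'
      refine ⟨Fin.cons (w 0) (Fin.cons (w 1) x), ?_, ?_⟩
      · simp only [mem_setOf_eq, Fin.cons_zero, Fin.cons_one, Fin.cons_succ]
        exact ⟨hw, hx⟩
      · rw [hΨ]
        funext j
        refine Fin.cases ?_ (fun j => Fin.cases ?_ (fun i => ?_) j) j
        · simp
        · simp
        · simp only [Fin.cons_succ]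
          exact congrFun hwx i
    · rintro ⟨z, ⟨hz, hz'⟩, rfl⟩
      refine ⟨?_, ?_⟩
      · rw [hΨ0, hΨ1]
        exact hz
      · simp only [hΨ2]
        rw [hdom]
        exact mem_image_of_mem Φ hz'
  · -- integrands
    intro z hz
    rw [hI, hI', hdet]
    simp only [hΨ2]
    exact hf _ (hmaps z hz)
  · -- both disc coordinates are preserved, hence so is membership of `(z 0, z 1)` in `T`
    intro z _
    rw [hΨ0 z, hΨ1 z]

/-- **Disc × (Newton–Leibniz) is Newton–Leibniz over a base of dimension `≥ 2`.** If `[r] − [r']`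
is rule (3) along the last coordinate over the base `r'.domain ⊆ ℝᵏ`, then `[P r] − [P r']` is a
Newton–Leibniz move with band `P (k+1) r : IntegralRep (k + 3)` over the base
`P k r' : IntegralRep (k + 2)` (`piMulFib_newtonLeibniz`, forgetting "fibred" down to
"Newton–Leibniz" by `KZ.fibredNewtonLeibnizRel_subset_newtonLeibnizRel`). [folklore] -/
theorem piMulRegion_newtonLeibniz {r : IntegralRep (k + 1)} {r' : IntegralRep k}
    {a b : (Fin k → ℝ) → ℝ} {F : (Fin (k + 1) → ℝ) → ℝ} (hF : IsSemialgebraicFunOn ℚ r.domain F)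
    (ha : IsSemialgebraicFunOn ℚ r'.domain a) (hb : IsSemialgebraicFunOn ℚ r'.domain b)
    (hab : ∀ x ∈ r'.domain, a x ≤ b x)
    (hdom : r.domain = {z | (Fin.init z : Fin k → ℝ) ∈ r'.domain ∧
      a (Fin.init z) ≤ z (Fin.last k) ∧ z (Fin.last k) ≤ b (Fin.init z)})
    (hcont : ∀ x ∈ r'.domain, ContinuousOn (fun t : ℝ => F (Fin.snoc x t)) (Icc (a x) (b x)))
    (hderiv : ∀ x ∈ r'.domain, ∀ t ∈ Ioo (a x) (b x),
      HasDerivAt (fun s : ℝ => F (Fin.snoc x s)) (r.integrand (Fin.snoc x t)) t)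
    (hr' : ∀ x ∈ r'.domain, r'.integrand x = F (Fin.snoc x (b x)) - F (Fin.snoc x (a x))) :
    of (P (k + 1) r) - of (P k r') ∈
      {x : FormalRep | x ∈ newtonLeibnizRel ∧
        ∃ (n : ℕ) (s : IntegralRep (n + 3)) (s' : IntegralRep (n + 2)), x = of s - of s'} :=
  ⟨fibredNewtonLeibnizRel_subset_newtonLeibnizRel
      (piMulFib_newtonLeibniz hP hF ha hb hab hdom hcont hderiv hr'),
    k, P (k + 1) r, P k r', rfl⟩

end Generators

/-! ### The stub -/

/-- STUB (disc multiples of relations are region-respecting relations, for EVERY region `T` of the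
two disc coordinates): `lift (of ∘ P)` maps `KZ.relations` into the closure of additivity, the changes
of variables preserving membership of `(z 0, z 1)` in `T`, and Newton–Leibniz over bases of dimension
`≥ 2`. [folklore] -/
theorem stub_piMulRegion :
    ∀ (T : Set (ℝ × ℝ)) (P : ∀ n : ℕ, IntegralRep n → IntegralRep (n + 2)), (∀ (n : ℕ) (r : IntegralRep n), (P n r).domain = {z : Fin (n + 2) → ℝ | z 0 ^ 2 + z 1 ^ 2 ≤ 1 ∧ (fun i : Fin n => z i.succ.succ) ∈ r.domain} ∧ (P n r).integrand = fun z => r.integrand (fun i : Fin n => z i.succ.succ)) → ∀ c : FormalRep, c ∈ relations → FreeAbelianGroup.lift (fun s : (Σ n, IntegralRep n) => of (P s.1 s.2)) c ∈ AddSubgroup.closure (domainAddRel ∪ integrandAddRel ∪ {x | ∃ (n : ℕ) (r r' : IntegralRep (n + 2)) (Φ : (Fin (n + 2) → ℝ) → (Fin (n + 2) → ℝ)) (Φ' : (Fin (n + 2) → ℝ) → (Fin (n + 2) → ℝ) →L[ℝ] (Fin (n + 2) → ℝ)), IsSemialgebraicMapOn ℚ r.domain Φ ∧ (∀ x ∈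 r.domain, HasFDerivWithinAt Φ (Φ' x) r.domain x) ∧ Set.InjOn Φ r.domain ∧ r'.domain = Φ '' r.domain ∧ (∀ x ∈ r.domain, r.integrand x = r'.integrand (Φ x) * |(Φ' x).det|) ∧ (∀ x ∈ r.domain, (Φ x 0, Φ x 1) ∈ T ↔ (x 0, x 1) ∈ T) ∧ x = of r - of r'} ∪ {x | x ∈ newtonLeibnizRel ∧ ∃ (n : ℕ) (r : IntegralRep (n + 3)) (r' : IntegralRep (n + 2)), x = of r - of r'}) := by
  intro T P hP c hc
  have hL : ∀ {m : ℕ} (s : IntegralRep m),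
      FreeAbelianGroup.lift (fun s : (Σ n, IntegralRep n) => of (P s.1 s.2)) (of s) = of (P m s) :=
    fun s => FreeAbelianGroup.lift_apply_of _ _
  refine (AddSubgroup.closure_le ((AddSubgroup.closure (domainAddRel ∪ integrandAddRel ∪ {x | ∃ (n : ℕ) (r r' : IntegralRep (n + 2)) (Φ : (Fin (n + 2) → ℝ) → (Fin (n + 2) → ℝ)) (Φ' : (Fin (n + 2) → ℝ) → (Fin (n + 2) → ℝ) →L[ℝ] (Fin (n + 2) → ℝ)), IsSemialgebraicMapOn ℚ r.domain Φ ∧ (∀ x ∈ r.domain, HasFDerivWithinAt Φ (Φ' x) r.domain x) ∧ Set.InjOn Φ r.domain ∧ r'.domain = Φ '' r.domain ∧ (∀ x ∈ r.domain, r.integrand x = r'.integrand (Φ x) * |(Φ' x).det|) ∧ (∀ x ∈ r.domain, (Φ x 0, Φ x 1) ∈ T ↔ (x 0, x 1) ∈ T) ∧ x = of r - of r'} ∪ {x | x ∈ newtonLeibnizRel ∧ ∃ (n : ℕ) (r : IntegralRep (n + 3)) (r' : IntegralRep (n + 2)), x = of r - of r'})).comap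
    (FreeAbelianGroup.lift (fun s : (Σ n, IntegralRep n) => of (P s.1 s.2))))).mpr ?_ hc
  rintro g (((hg | hg) | hg) | hg)
  · obtain ⟨k, r, r₁, r₂, hdom, hnull, h₁, h₂, rfl⟩ := hg
    rw [AddSubgroup.coe_comap, mem_preimage, map_sub, map_sub, hL, hL, hL]
    exact AddSubgroup.subset_closure (Or.inl (Or.inl (Or.inl (piMulFib_domainAdd hP hdom hnull h₁ h₂))))
  · obtain ⟨k, r, r₁, r₂, h₁, h₂, hadd, rfl⟩ := hg
    rw [AddSubgroup.coe_comap, mem_preimage, map_sub, map_sub, hL, hL, hL]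
    exact AddSubgroup.subset_closure (Or.inl (Or.inl (Or.inr (piMulFib_integrandAdd hP h₁ h₂ hadd))))
  · obtain ⟨k, r, r', Φ, Φ', hΦ, hΦ', hinj, hdom, hf, rfl⟩ := hg
    rw [AddSubgroup.coe_comap, mem_preimage, map_sub, hL, hL]
    exact AddSubgroup.subset_closure (Or.inl (Or.inr
      (piMulRegion_changeOfVariables hP T hΦ hΦ' hinj hdom hf)))
  · obtain ⟨k, r, r', α, β, F, hF, hα, hβ, hle, hband, hcont, hderiv, hr', rfl⟩ := hg
    rw [AddSubgroup.coe_comap, mem_preimage, map_sub, hL, hL]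
    exact AddSubgroup.subset_closure (Or.inr
      (piMulRegion_newtonLeibniz hP hF hα hβ hle hband hcont hderiv hr'))

end Summit.KontsevichZagierPeriods.KontsevichZagierPeriods.BetaCancellationLine
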